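import Mathlib
import Summits.Ventures.PercRepro2.HCov
import Summits.Ventures.PercRepro2.A3FibreA
import Summits.Ventures.PercRepro2.A3FibreWorlds

/-!
# The two factor inequalities of the residual (MEANS-a₃): `Δf ≥ 0` and `Δg ≥ 0`
(blind cell PercRepro2, p5 g12; `proofs/P5-A3FIBRE.md` §9 addendum v7, S4 §2.4 (n) addendum (vi))

In the three-term form of the (root-stopped) residual of the a₃-exploration the between-`(T′, T)`
term is `(1 − α)π′π · Δf · Δg` with `Δf = E_ν[σ_b | a₃ ∈ C₁] − E_ν[σ_b | a₃ ∈ C₂]` and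
`Δg = E_ν[F | a₃ ∈ C₁] − E_ν[F | a₃ ∈ C₂] = 2[γ − P(o ∈ C₂ | T′) − P(o ∈ C₁ | T)]`.  Both factors
are nonnegative, in cleared (division-free) form:

* **`factor_b`** (`Δf ≥ 0`): `P(T)·[P(T′, b ∈ C₁) − P(T′, b ∈ C₂)] ≥ P(T′)·[P(T, b ∈ C₁) − P(T, b ∈ C₂)]`
  — BHK06 Thm 1.3 (`bhk_same_cluster_events`: `b ∈ C₁` and `a₃ ∈ C₁` are positively correlated under
  `Q`) and Thm 1.4 (`bhk_cross_cluster_avoid`: `b ∈ C₁` and `a₃ ∈ C₂` negatively), on each side;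
* **`factor_o`** (`Δg ≥ 0`): `D·[P(T′, o ∈ C₂)·P(T) + P(T, o ∈ C₁)·P(T′)] ≤ D_o·P(T′)·P(T)` — the
  cell's margin lemma `ToL_mul_D_le` (`P(T, oL)·D ≤ P(PD, oL)·P(T)`) and its root-swap mirror.
Here `T = TEvent ends a₁ a₂ a₃ = {a₃ ∈ C₂}`, `T′ = TEvent ends a₂ a₁ a₃ = {a₃ ∈ C₁}`,
`D = P(PD)`, `D_o = P(PD, o ∈ U)` (HCov.lean).
-/

namespace Summit.Ventures.PercRepro2

open UnionCluster

namespace CovForm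

namespace A3Fibre

section Factors

variable {V : Type*} {E : Type*} [Fintype V] [DecidableEq V] [Fintype E] [DecidableEq E]
  {R : Type*} [Field R] [LinearOrder R] [IsStrictOrderedRing R]

omit [Fintype V] [DecidableEq V] [Fintype E] [DecidableEq E] in
/-- `T′ = {a₁ ↮ a₂} ∩ {a₁ ↔ a₃}` in the form of the BHK events. -/
lemma TEvent_swap_eq (ends : E → Sym2 V) (a₁ a₂ a₃ : V) :
    TEvent ends a₂ a₁ a₃ = clusterInEvent ends a₁ {W | a₃ ∈ W} ∩ (connEvent ends a₁ a₂)ᶜ := by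
  rw [TEvent, ← connEvent_eq_clusterInEvent, Set.inter_comm]

omit [Fintype V] [DecidableEq V] [Fintype E] [DecidableEq E] in
/-- `T = {a₁ ↮ a₂} ∩ {a₂ ↔ a₃}` in the form of the BHK events. -/
lemma TEvent_eq (ends : E → Sym2 V) (a₁ a₂ a₃ : V) :
    TEvent ends a₁ a₂ a₃ = clusterInEvent ends a₂ {W | a₃ ∈ W} ∩ avoidAll ends a₁ {a₂} := by
  rw [TEvent, ← connEvent_eq_clusterInEvent, avoidAll_eq_compl' ends a₂ a₁, Set.inter_comm]

omit [Fintype V] [DecidableEq V] [Fintype E] [DecidableEq E] in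
/-- `PDEvent` is symmetric in the roots. -/
lemma PDEvent_swap (ends : E → Sym2 V) (a₁ a₂ a₃ : V) :
    PDEvent ends a₂ a₁ a₃ = PDEvent ends a₁ a₂ a₃ := by
  ext ω
  simp only [PDEvent, Dtilde, inU, Set.mem_inter_iff, Set.mem_compl_iff, mem_connEvent,
    Set.mem_union]
  constructor
  · rintro ⟨h, h'⟩
    exact ⟨fun hc => h (conn_symm hc), fun hc => h' (Or.symm hc)⟩
  · rintro ⟨h, h'⟩
    exact ⟨fun hc => h (conn_symm hc), fun hc => h' (Or.symm hc)⟩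

/-- BHK 1.3 on the pair `(b ∈ C₁, a₃ ∈ C₁)`: `P(Q, b ∈ C₁)·P(T′) ≤ P(T′, b ∈ C₁)·P(Q)`. -/
lemma bhk_b_T' (p : E → R) (hp : IsProbVec p) (ends : E → Sym2 V) (a₁ a₂ a₃ b : V) :
    prob p (avoidAll ends a₂ {a₁} ∩ connEvent ends a₁ b) * prob p (TEvent ends a₂ a₁ a₃) ≤
      prob p (TEvent ends a₂ a₁ a₃ ∩ connEvent ends a₁ b) * prob p (avoidAll ends a₂ {a₁}) := by
  have h := bhk_same_cluster_events p hp ends a₁ a₂ (isUpperSet_mem_setOf b) (isUpperSet_mem_setOf a₃)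
  rw [← connEvent_eq_clusterInEvent, ← connEvent_eq_clusterInEvent] at h
  rw [avoidAll_eq_compl' ends a₁ a₂, TEvent_swap_eq, ← connEvent_eq_clusterInEvent]
  have e1 : connEvent ends a₁ a₃ ∩ (connEvent ends a₁ a₂)ᶜ ∩ connEvent ends a₁ b =
      connEvent ends a₁ b ∩ connEvent ends a₁ a₃ ∩ (connEvent ends a₁ a₂)ᶜ := by
    ext ω; simp only [Set.mem_inter_iff]; tauto
  have e2 : (connEvent ends a₁ a₂)ᶜ ∩ connEvent ends a₁ b =
      connEvent ends a₁ b ∩ (connEvent ends a₁ a₂)ᶜ := Set.inter_comm _ _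
  rw [e1, e2]
  linarith [h]

/-- BHK 1.4 on the pair `(b ∈ C₁, a₃ ∈ C₂)`: `P(T, b ∈ C₁)·P(Q) ≤ P(Q, b ∈ C₁)·P(T)`. -/
lemma bhk_b_T (p : E → R) (hp : IsProbVec p) (ends : E → Sym2 V) (a₁ a₂ a₃ b : V) :
    prob p (TEvent ends a₁ a₂ a₃ ∩ connEvent ends a₁ b) * prob p (avoidAll ends a₂ {a₁}) ≤
      prob p (avoidAll ends a₂ {a₁} ∩ connEvent ends a₁ b) * prob p (TEvent ends a₁ a₂ a₃) := by
  have h := bhk_cross_cluster_avoid p hp ends a₁ a₂ (Finset.mem_singleton_self a₂)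
    (isUpperSet_mem_setOf b) (isUpperSet_mem_setOf a₃)
  rw [← connEvent_eq_clusterInEvent, ← connEvent_eq_clusterInEvent] at h
  rw [TEvent_eq, ← connEvent_eq_clusterInEvent, avoidAll_symm ends a₁ a₂]
  have e1 : connEvent ends a₂ a₃ ∩ avoidAll ends a₁ {a₂} ∩ connEvent ends a₁ b =
      connEvent ends a₁ b ∩ connEvent ends a₂ a₃ ∩ avoidAll ends a₁ {a₂} := by
    ext ω; simp only [Set.mem_inter_iff]; tauto
  have e2 : avoidAll ends a₁ {a₂} ∩ connEvent ends a₁ b =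
      connEvent ends a₁ b ∩ avoidAll ends a₁ {a₂} := Set.inter_comm _ _
  rw [e1, e2]
  linarith [h]

/-- **The `b`-factor, one side**: `P(T′, b ∈ C₁)·P(T) ≥ P(T, b ∈ C₁)·P(T′)` (through `Q`). -/
lemma factor_b_one (p : E → R) (hp : IsProbVec p) (ends : E → Sym2 V) (a₁ a₂ a₃ b : V) :
    prob p (TEvent ends a₁ a₂ a₃ ∩ connEvent ends a₁ b) * prob p (TEvent ends a₂ a₁ a₃) ≤
      prob p (TEvent ends a₂ a₁ a₃ ∩ connEvent ends a₁ b) * prob p (TEvent ends a₁ a₂ a₃) := by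
  have h1 := bhk_b_T' p hp ends a₁ a₂ a₃ b
  have h2 := bhk_b_T p hp ends a₁ a₂ a₃ b
  by_cases hQ : prob p (avoidAll ends a₂ {a₁}) = 0
  · have hT : prob p (TEvent ends a₁ a₂ a₃ ∩ connEvent ends a₁ b) = 0 := by
      apply le_antisymm _ (prob_nonneg hp _)
      rw [← hQ]
      apply prob_mono hp
      intro ω hω
      rw [avoidAll_eq_compl]
      exact hω.1.1
    have hT' : prob p (TEvent ends a₂ a₁ a₃ ∩ connEvent ends a₁ b) = 0 := by
      apply le_antisymm _ (prob_nonneg hp _)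
      rw [← hQ]
      apply prob_mono hp
      intro ω hω
      rw [avoidAll_eq_compl']
      exact hω.1.1
    rw [hT, hT']
    simp
  · have hQpos : 0 < prob p (avoidAll ends a₂ {a₁}) :=
      lt_of_le_of_ne (prob_nonneg hp _) (Ne.symm hQ)
    have hT := prob_nonneg hp (TEvent ends a₁ a₂ a₃)
    have hT' := prob_nonneg hp (TEvent ends a₂ a₁ a₃)
    -- P(T,b1)·P(Q)·P(T′) ≤ P(Q,b1)·P(T)·P(T′) ≤ P(T′,b1)·P(Q)·P(T)
    have h3 := mul_le_mul_of_nonneg_right h2 hT'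
    have h4 := mul_le_mul_of_nonneg_right h1 hT
    have h5 : prob p (TEvent ends a₁ a₂ a₃ ∩ connEvent ends a₁ b) * prob p (TEvent ends a₂ a₁ a₃) *
        prob p (avoidAll ends a₂ {a₁}) ≤
        prob p (TEvent ends a₂ a₁ a₃ ∩ connEvent ends a₁ b) * prob p (TEvent ends a₁ a₂ a₃) *
        prob p (avoidAll ends a₂ {a₁}) := by nlinarith [h3, h4]
    exact le_of_mul_le_mul_right h5 hQpos

/-- **The `b`-factor, the other side** (the root swap): `P(T′, b ∈ C₂)·P(T) ≤ P(T, b ∈ C₂)·P(T′)`. -/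
lemma factor_b_two (p : E → R) (hp : IsProbVec p) (ends : E → Sym2 V) (a₁ a₂ a₃ b : V) :
    prob p (TEvent ends a₂ a₁ a₃ ∩ connEvent ends a₂ b) * prob p (TEvent ends a₁ a₂ a₃) ≤
      prob p (TEvent ends a₁ a₂ a₃ ∩ connEvent ends a₂ b) * prob p (TEvent ends a₂ a₁ a₃) :=
  factor_b_one p hp ends a₂ a₁ a₃ b

/-- **`Δf ≥ 0`, cleared**: `P(T′)·[P(T, b ∈ C₁) − P(T, b ∈ C₂)] ≤ P(T)·[P(T′, b ∈ C₁) − P(T′, b ∈ C₂)]`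
— the conditional mean of `σ_b` given `a₃ ∈ C₁` dominates the one given `a₃ ∈ C₂`. -/
theorem factor_b (p : E → R) (hp : IsProbVec p) (ends : E → Sym2 V) (a₁ a₂ a₃ b : V) :
    prob p (TEvent ends a₂ a₁ a₃) *
        (prob p (TEvent ends a₁ a₂ a₃ ∩ connEvent ends a₁ b) -
          prob p (TEvent ends a₁ a₂ a₃ ∩ connEvent ends a₂ b)) ≤
      prob p (TEvent ends a₁ a₂ a₃) *
        (prob p (TEvent ends a₂ a₁ a₃ ∩ connEvent ends a₁ b) -
          prob p (TEvent ends a₂ a₁ a₃ ∩ connEvent ends a₂ b)) := by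
  have h1 := factor_b_one p hp ends a₁ a₂ a₃ b
  have h2 := factor_b_two p hp ends a₁ a₂ a₃ b
  nlinarith [h1, h2]

/-- **`Δg ≥ 0`, cleared**: `D·[P(T′, o ∈ C₂)·P(T) + P(T, o ∈ C₁)·P(T′)] ≤ D_o·P(T′)·P(T)` — the
cell's margin lemma `ToL_mul_D_le` and its root-swap mirror. -/
theorem factor_o (p : E → R) (hp : IsProbVec p) (ends : E → Sym2 V) (o a₁ a₂ a₃ : V) :
    prob p (PDEvent ends a₁ a₂ a₃) *
        (prob p (TEvent ends a₂ a₁ a₃ ∩ connEvent ends a₂ o) * prob p (TEvent ends a₁ a₂ a₃) +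
          prob p (TEvent ends a₁ a₂ a₃ ∩ connEvent ends a₁ o) * prob p (TEvent ends a₂ a₁ a₃)) ≤
      Do p ends o a₁ a₂ a₃ * prob p (TEvent ends a₂ a₁ a₃) * prob p (TEvent ends a₁ a₂ a₃) := by
  have h1 := ToL_mul_D_le p hp ends o a₁ a₂ a₃
  have h2 := ToL_mul_D_le p hp ends o a₂ a₁ a₃
  rw [PDEvent_swap] at h2
  have hT := prob_nonneg hp (TEvent ends a₁ a₂ a₃)
  have hT' := prob_nonneg hp (TEvent ends a₂ a₁ a₃)
  unfold Do
  nlinarith [mul_le_mul_of_nonneg_right h1 hT', mul_le_mul_of_nonneg_right h2 hT]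

end Factors

end A3Fibre

end CovForm

end Summit.Ventures.PercRepro2
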